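import Summits.RiemannHypothesis.RiemannHypothesis.Theorems.IntegerScrewTopBlockPosSoundA

/-!
# P-POS soundness B: memberships of the cell pieces, `cell_sound`

Soundness of the P-POS kernel checker `IntegerScrewTopBlockPosDefs` for the crux `TopBlockWavePos31`
(= `Manifest.TopBlockWavePos (21/50) 8 31`) of route `ScrewNyquistFloor` (planner sos-theory gen17).
PROOF-ONLY module (all definitions, incl. the real twins `FR`, `mu`, `GoodBox`, …, live in `IntegerScrewTopBlockPosDefs`).
Part B: basic facts on the real cell quantities (`mbR`, `wR`, `pcR`, `p1R`, `hpR`, `DR`, `WR`, `GcapR`); on a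
cell `[P0,P1]/DP × {m : lo ≤ m ≤ hi}` every named piece of `cellLB` encloses its real counterpart (`mem_S1`,
`mem_S2`, `mem_gradM`, `mem_loss2`); `FR_lower` sums `edge_bound` over the 110 edges and regroups the gradient
term by vertex; `cell_sound` concludes `0 < F(φ, m)` from `accept (cellLB …) = true`.
Nothing here bears on the truth of RH; the block `D16` is prime-free.
-/

set_option linter.dupNamespace false
set_option autoImplicit false

namespace Summit.RiemannHypothesis.RiemannHypothesis.Theorems.IntegerScrew.TopBlockPos

open Literature.Analysis.ValidatedNumerics Literature.Analysis.ValidatedNumerics.Numerics FI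

section Cell

/-! ### The cell quantities: basic facts and memberships -/

/-- Soundness/assembly step `DP_pos` (P-POS package; see the module docstring). -/
theorem DP_pos : (0 : ℝ) < DP := by norm_num [DP]

/-- Soundness/assembly step `mem_pcI` (P-POS package; see the module docstring). -/
theorem mem_pcI (P0 P1 : ℕ) : mem (pcR P0 P1) (pcI P0 P1) := by
  have := mem_ofFrac ((P0 + P1 : ℕ) : ℤ) (q := 2 * DP) (by norm_num [DP])
  unfold pcR pcI; push_cast at this ⊢; exact this

/-- Soundness/assembly step `mem_p1I` (P-POS package; see the module docstring). -/
theorem mem_p1I (P1 : ℕ) : mem (p1R P1) (p1I P1) := by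
  have := mem_ofFrac (P1 : ℤ) (q := DP) (by norm_num [DP])
  unfold p1R p1I; push_cast at this ⊢; exact this

/-- Soundness/assembly step `mem_hpI` (P-POS package; see the module docstring). -/
theorem mem_hpI {P0 P1 : ℕ} (hP : P0 ≤ P1) : mem (hpR P0 P1) (hpI P0 P1) := by
  have := mem_ofFrac ((P1 - P0 : ℕ) : ℤ) (q := 2 * DP) (by norm_num [DP])
  unfold hpR hpI; push_cast [Nat.cast_sub hP] at this ⊢; exact this

/-- Soundness/assembly step `pcR_nonneg` (P-POS package; see the module docstring). -/
theorem pcR_nonneg (P0 P1 : ℕ) : 0 ≤ pcR P0 P1 := by unfold pcR; positivity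
/-- Soundness/assembly step `pcR_le_p1R` (P-POS package; see the module docstring). -/
theorem pcR_le_p1R {P0 P1 : ℕ} (hP : P0 ≤ P1) : pcR P0 P1 ≤ p1R P1 := by
  unfold pcR p1R
  have : (P0 : ℝ) ≤ P1 := by exact_mod_cast hP
  rw [div_le_div_iff₀ (mul_pos two_pos DP_pos) DP_pos]; nlinarith [DP_pos]
/-- Soundness/assembly step `hpR_nonneg` (P-POS package; see the module docstring). -/
theorem hpR_nonneg {P0 P1 : ℕ} (hP : P0 ≤ P1) : 0 ≤ hpR P0 P1 := by
  unfold hpR; have : (P0 : ℝ) ≤ P1 := by exact_mod_cast hP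
  exact div_nonneg (by linarith) (mul_pos two_pos DP_pos).le
/-- Soundness/assembly step `p1R_nonneg` (P-POS package; see the module docstring). -/
theorem p1R_nonneg (P1 : ℕ) : 0 ≤ p1R P1 := by unfold p1R; positivity

/-- Soundness/assembly step `abs_delta_le` (P-POS package; see the module docstring). -/
theorem abs_delta_le {P0 P1 : ℕ} {φ : ℝ} (h0 : (P0 : ℝ) / DP ≤ φ) (h1 : φ ≤ (P1 : ℝ) / DP) :
    |φ - pcR P0 P1| ≤ hpR P0 P1 := by
  have e0 : (P0 : ℝ) ≤ φ * DP := by rwa [div_le_iff₀ DP_pos] at h0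
  have e1 : φ * DP ≤ P1 := by rwa [le_div_iff₀ DP_pos] at h1
  have h2 : (0 : ℝ) < 2 * DP := mul_pos two_pos DP_pos
  have key : φ - pcR P0 P1 = (φ * DP * 2 - (P0 + P1)) / (2 * DP) := by
    unfold pcR; rw [eq_div_iff h2.ne', sub_mul, div_mul_cancel₀ _ h2.ne']; ring
  unfold hpR
  rw [key, abs_div, abs_of_pos h2]
  refine div_le_div_of_nonneg_right ?_ h2.le
  rw [abs_le]; constructor <;> linarith

/-! ### Column memberships -/

variable {M0 M1 : List FI} {lo hi m : ℕ → ℝ}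

/-- Soundness/assembly step `mem_mbR` (P-POS package; see the module docstring). -/
theorem mem_mbR (hlo : ∀ j, j < 16 → mem (lo j) (getI M0 j)) (hhi : ∀ j, j < 16 → mem (hi j) (getI M1 j))
    {j : ℕ} (hj : j < 16) : mem (mbR lo hi j) (getI (mList M0 M1) j) := by
  rw [mList, getI_map_range _ hj]
  have := mem_divNat (mem_add (hlo j hj) (hhi j hj)) (n := 2) two_pos
  unfold mbR; push_cast at this; exact this

/-- Soundness/assembly step `mem_wR` (P-POS package; see the module docstring). -/
theorem mem_wR (hlo : ∀ j, j < 16 → mem (lo j) (getI M0 j)) (hhi : ∀ j, j < 16 → mem (hi j) (getI M1 j))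
    {j : ℕ} (hj : j < 16) : mem (wR lo hi j) (getI (wList M0 M1) j) := by
  rw [wList, getI_map_range _ hj]
  have := mem_divNat (mem_sub (hhi j hj) (hlo j hj)) (n := 2) two_pos
  unfold wR; push_cast at this; exact this

/-- Soundness/assembly step `abs_eta_le` (P-POS package; see the module docstring). -/
theorem abs_eta_le (hm : ∀ j, lo j ≤ m j ∧ m j ≤ hi j) (j : ℕ) :
    |m j - mbR lo hi j| ≤ wR lo hi j := by
  unfold mbR wR; obtain ⟨h1, h2⟩ := hm j; rw [abs_le]; constructor <;> linarith

/-- Soundness/assembly step `abs_dm_le_DR` (P-POS package; see the module docstring). -/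
theorem abs_dm_le_DR (hlo : ∀ j, j < 16 → mem (lo j) (getI M0 j)) (hhi : ∀ j, j < 16 → mem (hi j) (getI M1 j))
    (hm : ∀ j, lo j ≤ m j ∧ m j ≤ hi j) {e : ℕ × ℕ × ℤ} (ha : e.1 < 16) (hb : e.2.1 < 16) :
    |m e.2.1 - m e.1| ≤ DR M0 M1 e := by
  have hsp : ∀ j, j < 16 → mem (m j) (span (getI M0 j) (getI M1 j)) := fun j hj =>
    mem_span (hlo j hj) (hhi j hj) (hm j).1 (hm j).2
  exact abs_le_absHi_div (mem_sub (hsp _ hb) (hsp _ ha))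

/-- Soundness/assembly step `wR_add_le_WR` (P-POS package; see the module docstring). -/
theorem wR_add_le_WR (hlo : ∀ j, j < 16 → mem (lo j) (getI M0 j)) (hhi : ∀ j, j < 16 → mem (hi j) (getI M1 j))
    {e : ℕ × ℕ × ℤ} (ha : e.1 < 16) (hb : e.2.1 < 16) :
    wR lo hi e.1 + wR lo hi e.2.1 ≤ WR M0 M1 e :=
  le_hi_div (mem_add (mem_wR hlo hhi ha) (mem_wR hlo hhi hb))

/-- Soundness/assembly step `DR_nonneg` (P-POS package; see the module docstring). -/
theorem DR_nonneg (hlo : ∀ j, j < 16 → mem (lo j) (getI M0 j)) (hhi : ∀ j, j < 16 → mem (hi j) (getI M1 j))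
    (hm : ∀ j, lo j ≤ m j ∧ m j ≤ hi j) {e : ℕ × ℕ × ℤ} (ha : e.1 < 16) (hb : e.2.1 < 16) :
    0 ≤ DR M0 M1 e := (abs_nonneg _).trans (abs_dm_le_DR hlo hhi hm ha hb)

/-- Soundness/assembly step `DR_le_dmax` (P-POS package; see the module docstring). -/
theorem DR_le_dmax {e : ℕ × ℕ × ℤ} (he : e ∈ edgeL) :
    DR M0 M1 e ≤ ((mkCol M0 M1).dmax : ℝ) / SC := by
  unfold DR; gcongr; exact_mod_cast le_foldr_max (List.mem_map_of_mem (f := dS M0 M1) he)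

/-- Soundness/assembly step `WR_le_wmax` (P-POS package; see the module docstring). -/
theorem WR_le_wmax {e : ℕ × ℕ × ℤ} (he : e ∈ edgeL) :
    WR M0 M1 e ≤ ((mkCol M0 M1).wmax : ℝ) / SC := by
  unfold WR; gcongr; exact_mod_cast le_foldr_max (List.mem_map_of_mem (f := wS M0 M1) he)

/-- Soundness/assembly step `G_le_GcapR` (P-POS package; see the module docstring). -/
theorem G_le_GcapR {P0 P1 : ℕ} (hP : P0 ≤ P1)
    (_hlo : ∀ j, j < 16 → mem (lo j) (getI M0 j)) (_hhi : ∀ j, j < 16 → mem (hi j) (getI M1 j))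
    {e : ℕ × ℕ × ℤ} (he : e ∈ edgeL) :
    hpR P0 P1 * DR M0 M1 e + p1R P1 * WR M0 M1 e ≤ GcapR M0 M1 P0 P1 := by
  have hg : mem (hpR P0 P1 * (((mkCol M0 M1).dmax : ℝ) / SC) + p1R P1 * (((mkCol M0 M1).wmax : ℝ) / SC))
      (gcapI (mkCol M0 M1) P0 P1) :=
    mem_add (mem_mul (mem_hpI hP) (mem_ofScaled _)) (mem_mul (mem_p1I P1) (mem_ofScaled _))
  refine le_trans ?_ (le_absHi_div hg)
  gcongr
  · exact hpR_nonneg hP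
  · exact DR_le_dmax he
  · exact p1R_nonneg P1
  · exact WR_le_wmax he

/-- Soundness/assembly step `mem_facI` (P-POS package; see the module docstring). -/
theorem mem_facI {P0 P1 : ℕ} (M0 M1 : List FI) :
    mem (1 / 2 + GcapR M0 M1 P0 P1 / 6) (facI (mkCol M0 M1) P0 P1) := by
  have := mem_add (mem_ofFrac 1 (q := 2) two_pos)
    (mem_divNat (mem_absUp_top (gcapI (mkCol M0 M1) P0 P1)) (n := 6) (by norm_num))
  unfold facI GcapR; push_cast at this ⊢; simpa using this

/-! ### Trigonometric data at the cell centre -/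

/-- Soundness/assembly step `mem_csL` (P-POS package; see the module docstring). -/
theorem mem_csL {P0 P1 : ℕ} (hlo : ∀ j, j < 16 → mem (lo j) (getI M0 j))
    (hhi : ∀ j, j < 16 → mem (hi j) (getI M1 j)) {j : ℕ} (hj : j < 16) :
    mem (Real.cos (pcR P0 P1 * mbR lo hi j)) ((csL (mkCol M0 M1) P0 P1).getD j trivCS).1 ∧
    mem (Real.sin (pcR P0 P1 * mbR lo hi j)) ((csL (mkCol M0 M1) P0 P1).getD j trivCS).2 := by
  rw [csL, getD_map_range _ _ hj]
  exact mem_cosSin (mem_mul (mem_pcI P0 P1) (mem_mbR hlo hhi hj))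

/-- Soundness/assembly step `memsT_TL` (P-POS package; see the module docstring). -/
theorem memsT_TL {P0 P1 : ℕ} (hlo : ∀ j, j < 16 → mem (lo j) (getI M0 j))
    (hhi : ∀ j, j < 16 → mem (hi j) (getI M1 j)) :
    MemsT (edgeL.map (fRe P0 P1 lo hi)) (TL (mkCol M0 M1) P0 P1) := by
  unfold TL
  refine memsT_map edgeL fun e he => ?_
  obtain ⟨ha, hb, -⟩ := edgeL_wf e he
  obtain ⟨hCa, hSa⟩ := mem_csL (P0 := P0) (P1 := P1) hlo hhi ha
  obtain ⟨hCb, hSb⟩ := mem_csL (P0 := P0) (P1 := P1) hlo hhi hb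
  refine ⟨rfl, ?_, ?_⟩
  · show mem (1 - Real.cos (thc P0 P1 lo hi e)) _
    have : thc P0 P1 lo hi e = pcR P0 P1 * mbR lo hi e.2.1 - pcR P0 P1 * mbR lo hi e.1 := by
      unfold thc; ring
    rw [this, Real.cos_sub]
    have h1 := mem_sub (Numerics.FI.mem_ofInt 1) (mem_add (mem_mul hCb hCa) (mem_mul hSb hSa))
    push_cast at h1; exact h1
  · show mem (Real.sin (thc P0 P1 lo hi e)) _
    have : thc P0 P1 lo hi e = pcR P0 P1 * mbR lo hi e.2.1 - pcR P0 P1 * mbR lo hi e.1 := by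
      unfold thc; ring
    rw [this, Real.sin_sub]
    exact mem_sub (mem_mul hSb hCa) (mem_mul hCb hSa)

/-! ### The five edge sums and their enclosures -/

/-- `S₁ = Σ (1 − cos θ_e(c)) k_e ∈ Φ(c)` -/
theorem mem_S1 {P0 P1 : ℕ} (hlo : ∀ j, j < 16 → mem (lo j) (getI M0 j))
    (hhi : ∀ j, j < 16 → mem (hi j) (getI M1 j)) :
    mem (edgeL.map fun e => (1 - Real.cos (thc P0 P1 lo hi e)) * (e.2.2 : ℝ)).sum
      (PhiI (mkCol M0 M1) P0 P1) := by
  have h := (memsT_TL (P0 := P0) (P1 := P1) hlo hhi).map_fst.sum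
  rw [List.map_map] at h; exact h

/-- `S₂ = Σ sin θ_e(c) k_e (m̄_b − m̄_a) ∈ ∂_φΦ(c)` -/
theorem mem_S2 {P0 P1 : ℕ} (hlo : ∀ j, j < 16 → mem (lo j) (getI M0 j))
    (hhi : ∀ j, j < 16 → mem (hi j) (getI M1 j)) :
    mem (edgeL.map fun e => Real.sin (thc P0 P1 lo hi e) * (e.2.2 : ℝ) *
        (mbR lo hi e.2.1 - mbR lo hi e.1)).sum (dPhiI (mkCol M0 M1) P0 P1) := by
  have hdm : Mems (edgeL.map fun e => mbR lo hi e.2.1 - mbR lo hi e.1) (mkCol M0 M1).dm :=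
    mems_map edgeL fun e he => by
      obtain ⟨ha, hb, -⟩ := edgeL_wf e he
      exact mem_sub (mem_mbR hlo hhi hb) (mem_mbR hlo hhi ha)
  have h := mems_dotL (memsT_TL (P0 := P0) (P1 := P1) hlo hhi).map_snd hdm
  rw [List.map_map, dotR_map] at h
  exact h

/-- `Σ_j |φ_c V_j| w_j ∈ gradMI` -/
theorem mem_gradM {P0 P1 : ℕ} (hlo : ∀ j, j < 16 → mem (lo j) (getI M0 j))
    (hhi : ∀ j, j < 16 → mem (hi j) (getI M1 j)) :
    mem (∑ j ∈ Finset.range 16, |pcR P0 P1 * vertexSumR (edgeL.map (fRe P0 P1 lo hi)) edgeL j| * wR lo hi j)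
      (gradMI (mkCol M0 M1) P0 P1) := by
  rw [← sum_range_list]
  unfold gradMI
  refine (mems_map (List.range 16) fun j hj => ?_).sum
  have hj' : j < 16 := List.mem_range.1 hj
  exact mem_mul (mem_absUp (mem_mul (mem_pcI P0 P1)
    (mem_vertexSum (memsT_TL (P0 := P0) (P1 := P1) hlo hhi) edgeL j))) (mem_wR hlo hhi hj')

/-- `S₄ = Σ W_e |k_e| ∈ sww` -/
theorem mem_S4 (M0 M1 : List FI) :
    mem (edgeL.map fun e => WR M0 M1 e * ((|e.2.2| : ℤ) : ℝ)).sum (mkCol M0 M1).sww :=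
  (mems_map edgeL fun _ _ => mem_mulInt (mem_ofScaled _) _).sum

/-- Soundness/assembly step `mem_bpp` (P-POS package; see the module docstring). -/
theorem mem_bpp (M0 M1 : List FI) :
    mem (edgeL.map fun e => DR M0 M1 e ^ 2 * ((|e.2.2| : ℤ) : ℝ)).sum (mkCol M0 M1).bpp :=
  (mems_map edgeL fun _ _ => mem_mulInt (mem_sqr (mem_ofScaled _)) _).sum

/-- Soundness/assembly step `mem_sdw` (P-POS package; see the module docstring). -/
theorem mem_sdw (M0 M1 : List FI) :
    mem (edgeL.map fun e => DR M0 M1 e * WR M0 M1 e * ((|e.2.2| : ℤ) : ℝ)).sum (mkCol M0 M1).sdw :=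
  (mems_map edgeL fun _ _ => mem_mulInt (mem_mul (mem_ofScaled _) (mem_ofScaled _)) _).sum

/-- Soundness/assembly step `mem_smm` (P-POS package; see the module docstring). -/
theorem mem_smm (M0 M1 : List FI) :
    mem (edgeL.map fun e => WR M0 M1 e ^ 2 * ((|e.2.2| : ℤ) : ℝ)).sum (mkCol M0 M1).smm :=
  (mems_map edgeL fun _ _ => mem_mulInt (mem_sqr (mem_ofScaled _)) _).sum

/-- `S₅ = Σ |k_e| G_e²`, expanded. -/
theorem S5_expand (M0 M1 : List FI) (hp p1 : ℝ) :
    (edgeL.map fun e => (hp * DR M0 M1 e + p1 * WR M0 M1 e) ^ 2 * ((|e.2.2| : ℤ) : ℝ)).sum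
      = (edgeL.map fun e => DR M0 M1 e ^ 2 * ((|e.2.2| : ℤ) : ℝ)).sum * hp ^ 2
        + hp * p1 * (edgeL.map fun e => DR M0 M1 e * WR M0 M1 e * ((|e.2.2| : ℤ) : ℝ)).sum * 2
        + p1 ^ 2 * (edgeL.map fun e => WR M0 M1 e ^ 2 * ((|e.2.2| : ℤ) : ℝ)).sum := by
  rw [mul_comm _ (hp ^ 2), ← List.sum_map_mul_left, mul_assoc (hp * p1), mul_comm (hp * p1),
    ← List.sum_map_mul_right, ← List.sum_map_mul_right, ← List.sum_map_mul_left,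
    ← List.sum_map_add, ← List.sum_map_add]
  congr 1
  refine List.map_congr_left fun e _ => ?_
  ring

/-- Soundness/assembly step `mem_loss2` (P-POS package; see the module docstring). -/
theorem mem_loss2 {P0 P1 : ℕ} (hP : P0 ≤ P1) (M0 M1 : List FI) :
    mem ((edgeL.map fun e => (hpR P0 P1 * DR M0 M1 e + p1R P1 * WR M0 M1 e) ^ 2 * ((|e.2.2| : ℤ) : ℝ)).sum
          * (1 / 2 + GcapR M0 M1 P0 P1 / 6)
        + hpR P0 P1 * (edgeL.map fun e => WR M0 M1 e * ((|e.2.2| : ℤ) : ℝ)).sum)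
      (loss2I (mkCol M0 M1) P0 P1) := by
  rw [S5_expand]
  have hq : mem ((edgeL.map fun e => DR M0 M1 e ^ 2 * ((|e.2.2| : ℤ) : ℝ)).sum * hpR P0 P1 ^ 2
        + hpR P0 P1 * p1R P1 * (edgeL.map fun e => DR M0 M1 e * WR M0 M1 e * ((|e.2.2| : ℤ) : ℝ)).sum * 2
        + p1R P1 ^ 2 * (edgeL.map fun e => WR M0 M1 e ^ 2 * ((|e.2.2| : ℤ) : ℝ)).sum)
      (quadI (mkCol M0 M1) P0 P1) := by
    have := mem_add (mem_add (mem_mul (mem_bpp M0 M1) (mem_sqr (mem_hpI hP)))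
      (mem_mulInt (mem_mul (mem_mul (mem_hpI hP) (mem_p1I P1)) (mem_sdw M0 M1)) 2))
      (mem_mul (mem_sqr (mem_p1I P1)) (mem_smm M0 M1))
    have h2 : ((2 : ℤ) : ℝ) = 2 := by norm_num
    rw [h2] at this; exact this
  exact mem_add (mem_mul hq (mem_facI M0 M1)) (mem_mul (mem_hpI hP) (mem_S4 M0 M1))

/-! ### The main inequality and the cell theorem -/

/-- Soundness/assembly step `FR_lower` (P-POS package; see the module docstring). -/
theorem FR_lower {P0 P1 : ℕ} (hP : P0 ≤ P1)
    (hlo : ∀ j, j < 16 → mem (lo j) (getI M0 j)) (hhi : ∀ j, j < 16 → mem (hi j) (getI M1 j))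
    (hm : ∀ j, lo j ≤ m j ∧ m j ≤ hi j) {φ : ℝ} (hφ0 : (P0 : ℝ) / DP ≤ φ) (hφ1 : φ ≤ (P1 : ℝ) / DP) :
    (edgeL.map fun e => (1 - Real.cos (thc P0 P1 lo hi e)) * (e.2.2 : ℝ)).sum
      + (φ - pcR P0 P1) * (edgeL.map fun e => Real.sin (thc P0 P1 lo hi e) * (e.2.2 : ℝ) *
          (mbR lo hi e.2.1 - mbR lo hi e.1)).sum
      + pcR P0 P1 * (edgeL.map fun e => Real.sin (thc P0 P1 lo hi e) * (e.2.2 : ℝ) *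
          ((m e.2.1 - mbR lo hi e.2.1) - (m e.1 - mbR lo hi e.1))).sum
    ≤ FR φ m + hpR P0 P1 * (edgeL.map fun e => WR M0 M1 e * ((|e.2.2| : ℤ) : ℝ)).sum
      + (1 / 2 + GcapR M0 M1 P0 P1 / 6) *
        (edgeL.map fun e => (hpR P0 P1 * DR M0 M1 e + p1R P1 * WR M0 M1 e) ^ 2 * ((|e.2.2| : ℤ) : ℝ)).sum := by
  unfold FR
  rw [← List.sum_map_mul_left, ← List.sum_map_mul_left, ← List.sum_map_mul_left, ← List.sum_map_mul_left,
    ← List.sum_map_add, ← List.sum_map_add, ← List.sum_map_add, ← List.sum_map_add]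
  refine List.sum_le_sum fun e he => ?_
  obtain ⟨ha, hb, -⟩ := edgeL_wf e he
  have hk : ((|e.2.2| : ℤ) : ℝ) = |(e.2.2 : ℝ)| := Int.cast_abs
  have h := edge_bound (e.2.2 : ℝ) (thc P0 P1 lo hi e)
    ((φ - pcR P0 P1) * (m e.2.1 - m e.1) + pcR P0 P1 * ((m e.2.1 - mbR lo hi e.2.1) - (m e.1 - mbR lo hi e.1)))
    (φ - pcR P0 P1) (pcR P0 P1) (p1R P1) (hpR P0 P1) (mbR lo hi e.2.1 - mbR lo hi e.1) (m e.2.1 - m e.1)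
    (m e.1 - mbR lo hi e.1) (m e.2.1 - mbR lo hi e.2.1) (wR lo hi e.1) (wR lo hi e.2.1)
    (WR M0 M1 e) (DR M0 M1 e) (GcapR M0 M1 P0 P1) rfl (by ring)
    (abs_delta_le hφ0 hφ1) (pcR_nonneg P0 P1) (pcR_le_p1R hP)
    (abs_dm_le_DR hlo hhi hm ha hb) (abs_eta_le hm _) (abs_eta_le hm _) (wR_add_le_WR hlo hhi ha hb)
    (G_le_GcapR hP hlo hhi he)
  have hth : thc P0 P1 lo hi e + ((φ - pcR P0 P1) * (m e.2.1 - m e.1)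
      + pcR P0 P1 * ((m e.2.1 - mbR lo hi e.2.1) - (m e.1 - mbR lo hi e.1))) = φ * (m e.2.1 - m e.1) := by
    unfold thc; ring
  rw [hth, ← hk] at h
  linarith [h]

/-- `φ_c S₃ = φ_c Σ_j η_j V_j ≥ −Σ_j |φ_c V_j| w_j`. -/
theorem S3_lower {P0 P1 : ℕ} (hm : ∀ j, lo j ≤ m j ∧ m j ≤ hi j) :
    -(∑ j ∈ Finset.range 16, |pcR P0 P1 * vertexSumR (edgeL.map (fRe P0 P1 lo hi)) edgeL j| * wR lo hi j)
      ≤ pcR P0 P1 * (edgeL.map fun e => Real.sin (thc P0 P1 lo hi e) * (e.2.2 : ℝ) *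
          ((m e.2.1 - mbR lo hi e.2.1) - (m e.1 - mbR lo hi e.1))).sum := by
  have hreg := regroup edgeL (edgeL.map (fRe P0 P1 lo hi)) (by simp) edgeL_wf (fun j => m j - mbR lo hi j)
  rw [zip_map_self, List.map_map] at hreg
  have hS : (edgeL.map fun e => Real.sin (thc P0 P1 lo hi e) * (e.2.2 : ℝ) *
      ((m e.2.1 - mbR lo hi e.2.1) - (m e.1 - mbR lo hi e.1))).sum
      = ∑ j ∈ Finset.range 16, (m j - mbR lo hi j) * vertexSumR (edgeL.map (fRe P0 P1 lo hi)) edgeL j := by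
    rw [← hreg]; rfl
  rw [hS, Finset.mul_sum, ← Finset.sum_neg_distrib]
  refine Finset.sum_le_sum fun j _ => ?_
  have h1 : |pcR P0 P1 * ((m j - mbR lo hi j) * vertexSumR (edgeL.map (fRe P0 P1 lo hi)) edgeL j)|
      ≤ |pcR P0 P1 * vertexSumR (edgeL.map (fRe P0 P1 lo hi)) edgeL j| * wR lo hi j := by
    rw [show pcR P0 P1 * ((m j - mbR lo hi j) * vertexSumR (edgeL.map (fRe P0 P1 lo hi)) edgeL j)
      = (pcR P0 P1 * vertexSumR (edgeL.map (fRe P0 P1 lo hi)) edgeL j) * (m j - mbR lo hi j) by ring,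
      abs_mul]
    exact mul_le_mul_of_nonneg_left (abs_eta_le hm j) (abs_nonneg _)
  have h2 := neg_abs_le (pcR P0 P1 * ((m j - mbR lo hi j) * vertexSumR (edgeL.map (fRe P0 P1 lo hi)) edgeL j))
  linarith

/-- CELL SOUNDNESS: an accepted cell is positive at every `φ` of its `φ`-range and every node vector
`m` bracketed by the column. -/
theorem cell_sound (M0 M1 : List FI) {P0 P1 : ℕ} (hP : P0 ≤ P1) (lo hi m : ℕ → ℝ)
    (hlo : ∀ j, j < 16 → mem (lo j) (getI M0 j)) (hhi : ∀ j, j < 16 → mem (hi j) (getI M1 j))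
    (hm : ∀ j, lo j ≤ m j ∧ m j ≤ hi j) {φ : ℝ} (hφ0 : (P0 : ℝ) / DP ≤ φ) (hφ1 : φ ≤ (P1 : ℝ) / DP)
    (hacc : accept (cellLB (mkCol M0 M1) P0 P1) = true) : 0 < FR φ m := by
  have h0 := of_decide_eq_true hacc
  have hmain := FR_lower hP hlo hhi hm hφ0 hφ1
  have h3 := S3_lower (P0 := P0) (P1 := P1) (lo := lo) (hi := hi) hm
  have hS2 := mem_S2 (P0 := P0) (P1 := P1) hlo hhi (M0 := M0) (M1 := M1)
  -- `δ S₂ ≥ −|S₂| h_φ`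
  have hδ := abs_delta_le (P0 := P0) (P1 := P1) hφ0 hφ1
  have h2 : -(|(edgeL.map fun e => Real.sin (thc P0 P1 lo hi e) * (e.2.2 : ℝ) *
          (mbR lo hi e.2.1 - mbR lo hi e.1)).sum| * hpR P0 P1)
      ≤ (φ - pcR P0 P1) * (edgeL.map fun e => Real.sin (thc P0 P1 lo hi e) * (e.2.2 : ℝ) *
          (mbR lo hi e.2.1 - mbR lo hi e.1)).sum := by
    have := neg_abs_le ((φ - pcR P0 P1) * (edgeL.map fun e => Real.sin (thc P0 P1 lo hi e) * (e.2.2 : ℝ) *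
          (mbR lo hi e.2.1 - mbR lo hi e.1)).sum)
    rw [abs_mul] at this
    nlinarith [abs_nonneg ((edgeL.map fun e => Real.sin (thc P0 P1 lo hi e) * (e.2.2 : ℝ) *
          (mbR lo hi e.2.1 - mbR lo hi e.1)).sum), abs_nonneg (φ - pcR P0 P1)]
  -- the certified enclosure of `S₁ − |S₂|h_φ − Σ|φ_cV_j|w_j − losses`
  have hx := mem_sub (mem_sub (mem_sub (mem_S1 (P0 := P0) (P1 := P1) hlo hhi (M0 := M0) (M1 := M1))
    (mem_mul (mem_absUp hS2) (mem_hpI hP))) (mem_gradM (P0 := P0) (P1 := P1) hlo hhi (M0 := M0) (M1 := M1)))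
    (mem_loss2 hP M0 M1)
  have hpos := pos_of_lo_pos hx h0
  linarith

end Cell

end Summit.RiemannHypothesis.RiemannHypothesis.Theorems.IntegerScrew.TopBlockPos
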